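import Literature.MathematicalPhysics.QuantumFieldTheory.Balaban1983to89.B11Ineq190ConcreteC
import Literature.MathematicalPhysics.QuantumFieldTheory.Balaban1983to89.B11Eq73KernelConcrete

/-!
# `Balaban1983to89.B11Ineq73HasMajConcrete` — T. Bałaban, *The variational problem and background fields in renormalization group method for lattice gauge theories*, Commun. Math. Phys. **102** (1985) 277–309 [Balaban1985Variational], (73) p. 289 and (190) p. 308: THE (73)-LETTER OF THE END-TO-END (190) CHAIN AT THE CONCRETE `C_j`, DISCHARGED BY A KERNEL ↔ BLOCK-SIZE DICTIONARY

statement-level skeleton of published theorems with citation tags; proofs where landed; nothing here is a claim about the Yang–Mills mass gap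

PDF held: `paper:balaban1985-cmp102-variational-background` (journal page = PDF page + 276); (73) p. 289 [PDF 13], verbatim: *«|𝔇(A′; c, b)| ≦
O(1)C₃ε₃(L^jη)^{−d+1}e^{−(1/2)δ₀d(c₋,y)}, b ∈ B^j(y), y ∈ Λ_j. (73)»* — READ, as everywhere in Sect. C of the tree, in the one-scale kernel form
of `B11Eq73KernelConcrete` (p06 g7), i.e. (tree units, no quotation) `|𝔇(A′)(X·e_b)(c)| ≤ O(1)·C₃(Lʲ)²·2ε·L^{−jd}·‖X‖·e^{−½δ₀|Lʲz_c − b|₁/Lʲ}`;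
(190) p. 308 [PDF 32] *«… ≤ O(1)(L^{j′}η)^{−d} exp(−⅛δ₀ d(y, y′)) for x ∈ Δ(y), y ∈ Λ_j, y′ ∈ Λ_{j′}»*; [3] = [Balaban1984PropagatorsII]
(2.51)–(2.52), (2.64)–(2.66) pp. 232–235 for the shape *«(size of Tμ near y) ≤ K(y, y′)·(size of μ), μ localised near y′»*
(`B11SectG.HasMaj`).
(v1.1 DOCFIX, r08 gen 28: the v1 header and the docstring of `hasMaj_fderiv_Dfix` carried the tree's READING «|𝔇(A′; b, c)| ≤ O(1)(L^jη)^{−d}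
exp(−½δ₀|b − c|)» INSIDE «…» quotes as if printed at (73) — reader r12 g19 QUOTE-AUDIT-B15 §E X1 (b); replaced by the verbatim display (page
image checked: argument order `(A′; c, b)`, the factors `C₃ε₃(L^jη)^{−d+1}`, the distance `d(c₋, y)` to the block of `b`) with the reading marked
as a reading; statements and proofs byte-identical.)

CITATION HEADER (lean-in-tree rule 2026-08-18).  WHAT IS REPRODUCED: no new printed statement — this file is the DICTIONARY between
the two readings of (73) already in the tree: the KERNEL reading (p06 g7 `B11Eq73KernelConcrete.ineq73_Dfix`: for the concrete remainder
`C_j(U₀, ·)` of [4] on `ℤᵈ`, `‖((δ/δA′)D(A′))(X·e_b)(c)‖ ≤ (1 − q)⁻¹e^{dδ₀}·C₃(Lʲ)²·2ε·L^{−jd}·‖X‖·e^{−½δ₀·|Lʲz_c − b|₁/Lʲ}`, modulo the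
H-kernel letter `hHker` = [5] Thm 3.12 in kernel form) and the BLOCK-SIZE reading used by the (190) chain (`B11SectG.HasMaj bN bB 𝔇 (θ_D
e^{−½δ₀d(y,y′)})`, the hypothesis `h73` of `B11Ineq190ConcreteC.ineq190_and_hmv_supSize_concreteC`, r08 g10).  Rows of
`HOME/lit-balaban-r08/ROWS-B11.md`: **B11.Eq73** and **B11.Eq190** (cell riders; heads unchanged).

WHAT THIS FILE PROVES (kernel, sorry-free; axioms `propext`/`Classical.choice`/`Quot.sound`).
* §1 THE GENERIC DICTIONARY [3] (2.64)–(2.66)-shape: **`hasMaj_supSize_of_kernel`** — for a real-linear `T : (X₁ → E₁) → (X₂ → E₂)`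
  between finite point sets blocked by `blk₁`, `blk₂` over any `B6.Geometry`, KERNEL BOUNDS `‖T(X·e_b)(c)‖ ≤ κ(c, b)‖X‖` together with
  the BLOCK ROW SUMS `Σ_{b : blk₁ b = y′} κ(c, b) ≤ K(y, y′)` for `c ∈ Δ(y)` give `HasMaj (supSize g box₁ blk₁) (supSize g box₂ blk₂) T K`
  (r11's sup sizes `B11SupSize190.supSize` on both sides).
* §2 THE SINGLE-SCALE CUBE GEOMETRY ON `ℤᵈ` (the `Λ_j`-blocks of Sect. C: `Lʲ`-cubes of the fine lattice, `ℓ¹` block distance):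
  `cube` (`⌊x/Lʲ⌋` coordinatewise), `loK_cube_le`/`lt_loK_cube_add` (a fine site lies in its cube), `card_filter_cube_le` (≤ d·L^{jd}
  bonds per cube), `l1_loK_sub_ge` (the offset inequality `|Lʲy − b|₁/Lʲ ≥ |y − cube b|₁ − d`), the geometry `cubeGeometry`
  (def, `B6.Geometry` with `dist y y′ = |y − y′|₁`), `triangle254_cubeGeometry`, `dist_nonneg_cubeGeometry`, **`rowSum_cubeGeometry`**
  (Lemma 2.1 [3] shape at any rate `αδ₀`, constant `c₀(δ₀, α)ᵈ`, by `B6Lemma21TwoScale.singleScale_row_sum`), the block maps `blkS`/`blkT`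
  and boxes, and the two compatibility letters of the chain for the sup sizes: `loc_le_norm_supSize` (`hN`), `norm_le_loc_of_isLoc`
  (`hBloc`).
* §3 **(73) AS A `HasMaj` LETTER, CONCRETE**: **`hasMaj_fderiv_Dfix`** — in the regime of `B11Eq73KernelConcrete.ineq73_Dfix` (regular
  background, `‖A′‖ < ε`, `9C₂(Lʲ)²B₀ε < 1`, `3ε < b`, `hHker`, `q < 1`), the actual derivative `fderiv ℂ (Dfix (Cmap L U₀ S T j) H C₂(Lʲ)²) A′`
  has the majorant `θ_D·e^{−½δ₀|y − y′|₁}` from the fine-bond sup size to the coarse-bond sup size of the cube geometry, with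
  `θ_D = d·e^{½dδ₀}·(1 − q)⁻¹·e^{dδ₀}·C₃(Lʲ)²·2ε` (the `L^{−jd}` of (73) cancels the `d·L^{jd}` bonds of a cube).
* §4 **THE (190) CHAIN AT THE CONCRETE `C_j` WITH THE (73)-LETTER DISCHARGED**: **`ineq190_and_hmv_supSize_concreteC_kernel`** —
  `B11Ineq190ConcreteC.ineq190_and_hmv_supSize_concreteC` on the cube geometry with `bN`, `bB` the sup sizes, and `h73`, `hN`, `hBloc`,
  `htri`, `hd`, `hrow` ALL DISCHARGED (the row sum at rate `⅛δ₀` with `c = c₀(δ₀, ⅛)ᵈ`); hypotheses left: the located leaves (189) `h189`,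
  the kernel letters of the ABSTRACT Sect. G data `G̃`, `Δ⁽²⁾H₀`, `H₀`, `H` on the cube sizes, the H-kernel letter `hHker`, the smallness
  `hq`/`hqK` and the regime letters, `Regime`, `W`-analyticity, (46).

HONEST SCOPE.  Single scale `Λ_j` (the multiscale `d(y, y′)` of [3] (2.46) restricted to one layer is the `ℓ¹` block distance up to the
factor `R M`, which is absorbed nowhere here: the geometry's `dist` IS `|y − y′|₁` in `Lʲ`-units, exactly the distance of p06's kernel
files); `G̃`, `W`, `Δ⁽²⁾`, `H₀`, `H` abstract; nothing of [5]/[6] constructed; the `O(1)` of (73) is p06's explicit constant; not summit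
progress.  Imports `B11Ineq190ConcreteC` (r08 g10) and `B11Eq73KernelConcrete` (p06 g7); re-declares nothing; no new named fact.
-/

noncomputable section

open scoped BigOperators
open Finset

namespace Literature.MathematicalPhysics.QuantumFieldTheory.Balaban1983to89.B11Ineq73HasMajConcrete

open Literature.MathematicalPhysics.QuantumFieldTheory.Balaban1983to89
open B11SectG B11SupSize190

/-! ## §1 The generic dictionary: kernel bounds + block row sums ⇒ `HasMaj` between sup sizes -/

section Dictionary

variable {g : B6.Geometry} [DecidableEq g.Site] {X₁ X₂ : Type} [Fintype X₁] [DecidableEq X₁] {E₁ E₂ : Type}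
  [NormedAddCommGroup E₁] [NormedSpace ℝ E₁] [NormedAddCommGroup E₂] [NormedSpace ℝ E₂]

/-- **KERNEL BOUNDS ⇒ MAJORANT** ([3] (2.64)–(2.66) shape, *«(size of Tμ near y) ≤ K(y, y′)·(size of μ), μ localised near y′»*):
if `‖T(X·e_b)(c)‖ ≤ κ(c, b)‖X‖` for all fine points `b`, values `X` and coarse points `c`, every fine point lies in the box of its
block, and the block row sums satisfy `Σ_{b : blk₁ b = y′} κ(c, b) ≤ K(y, y′)` for `c` in the box of `y`, then `T` has the majorant `K`
between the sup sizes. [cite: Balaban1984PropagatorsII, (2.64)–(2.66) p.235, (2.51)–(2.52) p.232] [cite: Balaban1985Variational, (73) p.289, (190) p.308] -/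
theorem hasMaj_supSize_of_kernel (box₁ : g.Site → Finset X₁) (blk₁ : X₁ → g.Site) (box₂ : g.Site → Finset X₂)
    (blk₂ : X₂ → g.Site) (hbox₁ : ∀ x, x ∈ box₁ (blk₁ x)) (T : (X₁ → E₁) →ₗ[ℝ] (X₂ → E₂)) (κ : X₂ → X₁ → ℝ)
    (hκ : ∀ c b, 0 ≤ κ c b) (hT : ∀ (b : X₁) (v : E₁) (c : X₂), ‖T (Pi.single b v) c‖ ≤ κ c b * ‖v‖)
    (K : g.Site → g.Site → ℝ) (hK0 : ∀ y y', 0 ≤ K y y')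
    (hK : ∀ (y y' : g.Site), ∀ c ∈ box₂ y, ∑ b ∈ univ.filter (fun b => blk₁ b = y'), κ c b ≤ K y y') :
    HasMaj (supSize g box₁ blk₁ : BlockNorm g (X₁ → E₁)) (supSize g box₂ blk₂ : BlockNorm g (X₂ → E₂)) T K := by
  intro y' μ hμ y
  have hμ' : ∀ b, blk₁ b ≠ y' → μ b = 0 := (supSize_isLoc_iff y' μ).1 hμ
  set ℓ := (supSize g box₁ blk₁ : BlockNorm g (X₁ → E₁)).loc y' μ with hℓ_def
  have hℓ0 : 0 ≤ ℓ := (supSize g box₁ blk₁ : BlockNorm g (X₁ → E₁)).loc_nonneg y' μ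
  have hμb : ∀ b, ‖μ b‖ ≤ (if blk₁ b = y' then ℓ else 0) := by
    intro b
    by_cases hb : blk₁ b = y'
    · rw [if_pos hb, hℓ_def, ← hb]
      exact norm_apply_le_loc (hbox₁ b) μ
    · rw [if_neg hb, hμ' b hb, norm_zero]
  refine loc_le_of_forall (mul_nonneg (hK0 y y') hℓ0) fun c hc => ?_
  -- decompose μ along the fine points and bound termwise
  have hdec : T μ = ∑ b, T (Pi.single b (μ b)) := by
    rw [← map_sum, Finset.univ_sum_single]
  calc ‖T μ c‖ = ‖∑ b, T (Pi.single b (μ b)) c‖ := by rw [hdec, Finset.sum_apply]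
    _ ≤ ∑ b, ‖T (Pi.single b (μ b)) c‖ := norm_sum_le _ _
    _ ≤ ∑ b, κ c b * (if blk₁ b = y' then ℓ else 0) :=
        Finset.sum_le_sum fun b _ => (hT b (μ b) c).trans (mul_le_mul_of_nonneg_left (hμb b) (hκ c b))
    _ = ∑ b ∈ univ.filter (fun b => blk₁ b = y'), κ c b * ℓ := by
        rw [Finset.sum_filter]
        refine Finset.sum_congr rfl fun b _ => ?_
        split_ifs <;> simp
    _ = (∑ b ∈ univ.filter (fun b => blk₁ b = y'), κ c b) * ℓ := by rw [Finset.sum_mul]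
    _ ≤ K y y' * ℓ := mul_le_mul_of_nonneg_right (hK y y' c hc) hℓ0

omit [DecidableEq X₁] in
/-- For the sup size with the SHARP boxes `box y = {x : blk x = y}`: `loc y v ≤ ‖v‖` (the letter `hN` of the (190) chain).
[cite: Balaban1985Variational, (190) p.308] -/
theorem loc_le_norm_supSize (blk₁ : X₁ → g.Site) (y : g.Site) (v : X₁ → E₁) :
    (supSize g (fun y => univ.filter fun x => blk₁ x = y) blk₁ : BlockNorm g (X₁ → E₁)).loc y v ≤ ‖v‖ :=
  loc_le_of_forall (norm_nonneg v) fun x _ => norm_le_pi_norm v x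

omit [DecidableEq X₁] in
/-- For the sup size with the sharp boxes: a field localised in the block of `y′` has sup norm `≤ loc y′` (the letter `hBloc`).
[cite: Balaban1985Variational, (190) p.308] -/
theorem norm_le_loc_of_isLoc (blk₁ : X₁ → g.Site) (y' : g.Site) (μ : X₁ → E₁)
    (hμ : (supSize g (fun y => univ.filter fun x => blk₁ x = y) blk₁ : BlockNorm g (X₁ → E₁)).IsLoc y' μ) :
    ‖μ‖ ≤ (supSize g (fun y => univ.filter fun x => blk₁ x = y) blk₁ : BlockNorm g (X₁ → E₁)).loc y' μ := by
  have hμ' : ∀ b, blk₁ b ≠ y' → μ b = 0 := (supSize_isLoc_iff y' μ).1 hμ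
  refine (pi_norm_le_iff_of_nonneg ((supSize g _ blk₁ : BlockNorm g (X₁ → E₁)).loc_nonneg y' μ)).2 fun b => ?_
  by_cases hb : blk₁ b = y'
  · exact norm_apply_le_loc (Finset.mem_filter.2 ⟨Finset.mem_univ b, hb⟩) μ
  · rw [hμ' b hb, norm_zero]
    exact (supSize g _ blk₁ : BlockNorm g (X₁ → E₁)).loc_nonneg y' μ

end Dictionary

/-! ## §2 The single-scale cube geometry on `ℤᵈ` -/

section CubeGeometry

open B7Prop1Explicit B7Prop1Local

-- the `ℤ^d` sites and `ℓ¹` length are written `B7Prop1Explicit.Site` / `B7Prop1Explicit.l1` (the bare names would resolve to the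
-- torus vocabulary of `Setup.lean`)

variable {d : ℕ}

/-- The `Lʲ`-cube (block of `Λ_j`) of a fine site: `⌊x/Lʲ⌋` coordinatewise. [cite: Balaban1985Variational, Sect. C p.285 («on Λ_j»), (73) p.289] -/
def cube (L j : ℕ) (x : B7Prop1Explicit.Site d) : B7Prop1Explicit.Site d := fun i => x i / ((L : ℤ) ^ j)

/-- A fine site lies in its cube: `Lʲ·⌊x/Lʲ⌋ ≤ x` coordinatewise (`L ≥ 1`). [folklore] -/
private theorem loK_cube_le {L : ℕ} (hL : 1 ≤ L) (j : ℕ) (x : B7Prop1Explicit.Site d) (i : Fin d) : loK L j (cube L j x) i ≤ x i := by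
  have hpos : (0 : ℤ) < (L : ℤ) ^ j := by positivity
  have h : ((L : ℤ) ^ j) * (x i / (L : ℤ) ^ j) + x i % (L : ℤ) ^ j = x i := Int.mul_ediv_add_emod (x i) ((L : ℤ) ^ j)
  have hr := Int.emod_nonneg (x i) hpos.ne'
  simp only [loK, cube]
  linarith

/-- … and `x < Lʲ·(⌊x/Lʲ⌋ + 1)` coordinatewise. [folklore] -/
private theorem lt_loK_cube_add {L : ℕ} (hL : 1 ≤ L) (j : ℕ) (x : B7Prop1Explicit.Site d) (i : Fin d) :
    x i < loK L j (cube L j x) i + (L : ℤ) ^ j := by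
  have hpos : (0 : ℤ) < (L : ℤ) ^ j := by positivity
  have h : ((L : ℤ) ^ j) * (x i / (L : ℤ) ^ j) + x i % (L : ℤ) ^ j = x i := Int.mul_ediv_add_emod (x i) ((L : ℤ) ^ j)
  have hr := Int.emod_lt_of_pos (x i) hpos
  simp only [loK, cube]
  linarith

/-- `ℓ¹` is symmetric under `v ↦ −v`: `|a − b|₁ = |b − a|₁`. [folklore] -/
private theorem l1_sub_comm (a b : B7Prop1Explicit.Site d) : B7Prop1Explicit.l1 (a - b) = B7Prop1Explicit.l1 (b - a) := by
  rw [← l1_neg, neg_sub]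

/-- The `ℓ¹` triangle inequality for differences. [folklore] -/
private theorem l1_sub_triangle (a b c : B7Prop1Explicit.Site d) : B7Prop1Explicit.l1 (a - c) ≤ B7Prop1Explicit.l1 (a - b) + B7Prop1Explicit.l1 (b - c) := by
  have h := l1_add_le (a - b) (b - c)
  rwa [sub_add_sub_cancel] at h

/-- THE OFFSET INEQUALITY: for a fine site `b` in the cube of `q = ⌊b/Lʲ⌋` and a coarse site `y`,
`Lʲ·|y − q|₁ ≤ |Lʲy − b|₁ + d·Lʲ`. [folklore] -/
private theorem l1_loK_sub_ge {L : ℕ} (hL : 1 ≤ L) (j : ℕ) (y b : B7Prop1Explicit.Site d) :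
    (L : ℝ) ^ j * (B7Prop1Explicit.l1 (y - cube L j b) : ℝ) ≤ (B7Prop1Explicit.l1 (loK L j y - b) : ℝ) + d * (L : ℝ) ^ j := by
  have hcoord : ∀ i : Fin d, ((L : ℤ) ^ j) * |y i - cube L j b i| ≤ |loK L j y i - b i| + (L : ℤ) ^ j := by
    intro i
    have h1 := loK_cube_le hL j b i
    have h2 := lt_loK_cube_add hL j b i
    have hpos : (0 : ℤ) < (L : ℤ) ^ j := by positivity
    -- Lʲ y_i − b_i = Lʲ (y_i − q_i) − (b_i − Lʲ q_i), with 0 ≤ b_i − Lʲ q_i < Lʲ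
    have hloK : loK L j y i = (L : ℤ) ^ j * y i := rfl
    have hloKq : loK L j (cube L j b) i = (L : ℤ) ^ j * cube L j b i := rfl
    rw [hloK]
    rw [hloKq] at h1 h2
    have key : ((L : ℤ) ^ j) * |y i - cube L j b i| = |(L : ℤ) ^ j * y i - (L : ℤ) ^ j * cube L j b i| := by
      rw [← mul_sub, abs_mul, abs_of_pos hpos]
    rw [key]
    have htri : |(L : ℤ) ^ j * y i - (L : ℤ) ^ j * cube L j b i|
        ≤ |(L : ℤ) ^ j * y i - b i| + |b i - (L : ℤ) ^ j * cube L j b i| := by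
      have := abs_sub_le ((L : ℤ) ^ j * y i) (b i) ((L : ℤ) ^ j * cube L j b i)
      exact this
    have hsmall : |b i - (L : ℤ) ^ j * cube L j b i| ≤ (L : ℤ) ^ j := by
      rw [abs_of_nonneg (by linarith)]
      linarith
    linarith
  -- sum over coordinates and cast
  have hsum : ((L : ℤ) ^ j) * (B7Prop1Explicit.l1 (y - cube L j b) : ℤ) ≤ (B7Prop1Explicit.l1 (loK L j y - b) : ℤ) + d * (L : ℤ) ^ j := by
    simp only [l1, Nat.cast_sum, Int.natCast_natAbs, Pi.sub_apply, Finset.mul_sum]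
    calc ∑ i, (L : ℤ) ^ j * |y i - cube L j b i| ≤ ∑ i : Fin d, (|loK L j y i - b i| + (L : ℤ) ^ j) :=
          Finset.sum_le_sum fun i _ => hcoord i
      _ = ∑ i, |loK L j y i - b i| + d * (L : ℤ) ^ j := by
          rw [Finset.sum_add_distrib, Finset.sum_const, Finset.card_univ, Fintype.card_fin]; simp
  have hcast : ((L : ℝ) ^ j) * (B7Prop1Explicit.l1 (y - cube L j b) : ℝ) = (((((L : ℤ) ^ j) * (B7Prop1Explicit.l1 (y - cube L j b) : ℤ)) : ℤ) : ℝ) := by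
    push_cast; ring
  rw [hcast]
  have h2 : ((B7Prop1Explicit.l1 (loK L j y - b) : ℝ) + d * (L : ℝ) ^ j) = ((((B7Prop1Explicit.l1 (loK L j y - b) : ℤ) + d * (L : ℤ) ^ j : ℤ)) : ℝ) := by
    push_cast; ring
  rw [h2]
  exact_mod_cast hsum

/-- THE DECAY OFFSET: `e^{−½δ₀·|Lʲy − b|₁/Lʲ} ≤ e^{½dδ₀}·e^{−½δ₀|y − ⌊b/Lʲ⌋|₁}` (`δ₀ ≥ 0`). [folklore] -/
private theorem exp_offset_le {L : ℕ} (hL : 1 ≤ L) (j : ℕ) {δ₀ : ℝ} (hδ₀ : 0 ≤ δ₀) (y b : B7Prop1Explicit.Site d) :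
    Real.exp (-(1 / 2 * δ₀ * ((B7Prop1Explicit.l1 (loK L j y - b) : ℝ) / (L : ℝ) ^ j)))
      ≤ Real.exp (1 / 2 * d * δ₀) * Real.exp (-(1 / 2 * δ₀ * (B7Prop1Explicit.l1 (y - cube L j b) : ℝ))) := by
  rw [← Real.exp_add]
  apply Real.exp_le_exp.2
  have hLj : (0 : ℝ) < (L : ℝ) ^ j := by positivity
  have h := l1_loK_sub_ge hL j y b
  have h' : (B7Prop1Explicit.l1 (y - cube L j b) : ℝ) - d ≤ (B7Prop1Explicit.l1 (loK L j y - b) : ℝ) / (L : ℝ) ^ j := by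
    rw [le_div_iff₀ hLj]
    nlinarith
  nlinarith

/-- The fine sites of the cube of `q`: `Π_i [Lʲq_i, Lʲq_i + Lʲ)`, a box of `(Lʲ)ᵈ` sites. [folklore] -/
private def cubeSites (L j : ℕ) (q : B7Prop1Explicit.Site d) : Finset (B7Prop1Explicit.Site d) :=
  Fintype.piFinset fun i => Finset.Ico (((L : ℤ) ^ j) * q i) (((L : ℤ) ^ j) * q i + (L : ℤ) ^ j)

/-- A fine site belongs to the site box of its cube. [folklore] -/
private theorem mem_cubeSites {L : ℕ} (hL : 1 ≤ L) (j : ℕ) (x : B7Prop1Explicit.Site d) : x ∈ cubeSites L j (cube L j x) := by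
  refine Fintype.mem_piFinset.2 fun i => Finset.mem_Ico.2 ⟨?_, ?_⟩
  · exact loK_cube_le hL j x i
  · exact lt_loK_cube_add hL j x i

/-- The site box of a cube has `(Lʲ)ᵈ` sites. [folklore] -/
private theorem card_cubeSites (L j : ℕ) (q : B7Prop1Explicit.Site d) : (cubeSites L j q).card = (L ^ j) ^ d := by
  rw [cubeSites, Fintype.card_piFinset]
  have hI : ∀ i : Fin d, (Finset.Ico (((L : ℤ) ^ j) * q i) (((L : ℤ) ^ j) * q i + (L : ℤ) ^ j)).card = L ^ j := by
    intro i
    rw [Int.card_Ico, add_sub_cancel_left]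
    have hc : ((L : ℤ) ^ j) = ((L ^ j : ℕ) : ℤ) := by push_cast; rfl
    rw [hc, Int.toNat_natCast]
  simp only [hI, Finset.prod_const, Finset.card_univ, Fintype.card_fin]

/-- **AT MOST `d·L^{jd}` BONDS PER CUBE**: the fine bonds of `S` whose base point lies in the cube of `q`.
[cite: Balaban1985Variational, (73) p.289 («(L^jη)^{−d}»)] -/
theorem card_filter_cube_le {L : ℕ} (hL : 1 ≤ L) (j : ℕ) (S : Finset (B7Prop1Explicit.Site d × Fin d)) (q : B7Prop1Explicit.Site d) :
    ((Finset.univ : Finset S).filter (fun s : S => cube L j s.1.1 = q)).card ≤ d * (L ^ j) ^ d := by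
  classical
  have hinj : Set.InjOn (fun s : S => (s : B7Prop1Explicit.Site d × Fin d))
      ↑((Finset.univ : Finset S).filter (fun s : S => cube L j s.1.1 = q)) := fun a _ b _ h => Subtype.ext h
  have hmaps : ∀ s ∈ (Finset.univ : Finset S).filter (fun s : S => cube L j s.1.1 = q),
      (s : B7Prop1Explicit.Site d × Fin d) ∈ cubeSites L j q ×ˢ (Finset.univ : Finset (Fin d)) := by
    intro s hs
    rw [Finset.mem_filter] at hs
    refine Finset.mem_product.2 ⟨?_, Finset.mem_univ _⟩
    rw [← hs.2]
    exact mem_cubeSites hL j _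
  calc ((Finset.univ : Finset S).filter (fun s : S => cube L j s.1.1 = q)).card
      ≤ (cubeSites L j q ×ˢ (Finset.univ : Finset (Fin d))).card := Finset.card_le_card_of_injOn _ hmaps hinj
    _ = d * (L ^ j) ^ d := by rw [Finset.card_product, card_cubeSites, Finset.card_univ, Fintype.card_fin, mul_comm]

/-- The coarse sites carrying the single-scale geometry of the pair `(S, T)`: the positions of the coarse bonds of `T` and the
cubes of the fine bonds of `S` (a finite set). [cite: Balaban1985Variational, Sect. C p.285 («on Λ_j»)] -/
def sites (L j : ℕ) (S T : Finset (B7Prop1Explicit.Site d × Fin d)) : Finset (B7Prop1Explicit.Site d) :=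
  T.image (fun c => c.1) ∪ S.image (fun s => cube L j s.1)

/-- **THE SINGLE-SCALE CUBE GEOMETRY** as a `B6.Geometry`: sites = `sites L j S T`, `dist y y′ = |y − y′|₁` (block distance in
`Lʲ`-units, the distance of the exponent of (73)), one scale `j`; the localisation vocabulary of [3] Props 2.2–2.8 is not used at one
scale and is filled trivially. [cite: Balaban1985Variational, (73) p.289] [cite: Balaban1984PropagatorsII, (2.45)–(2.46) p.229] -/
@[reducible] def cubeGeometry (L j : ℕ) (S T : Finset (B7Prop1Explicit.Site d × Fin d)) : B6.Geometry where
  Site := ↥(sites L j S T)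
  fin := inferInstance
  scale := fun _ => j
  dist := fun y y' => (B7Prop1Explicit.l1 (Subtype.val y - Subtype.val y') : ℝ)
  k := j
  eta := 1
  L := L
  R := 1
  M := 1
  Hyp21_22 := True
  Loc := Unit
  suppIn := fun _ _ => True
  supNorm := fun _ => 0
  l2Norm := fun _ => 0
  holder := fun _ _ => 0
  Cut := Unit
  cutIn := fun _ _ => True
  cutH := fun _ _ => 0
  cutSup := fun _ => 0

/-- Unfolding the distance. [cite: Balaban1985Variational, (73) p.289] -/
@[simp] theorem dist_cubeGeometry (L j : ℕ) (S T : Finset (B7Prop1Explicit.Site d × Fin d)) (y y' : (cubeGeometry L j S T).Site) :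
    (cubeGeometry L j S T).dist y y' = (B7Prop1Explicit.l1 (Subtype.val y - Subtype.val y') : ℝ) := rfl

/-- (2.54) for the cube geometry: the `ℓ¹` triangle inequality. [cite: Balaban1984PropagatorsII, (2.54) p.233] -/
theorem triangle254_cubeGeometry (L j : ℕ) (S T : Finset (B7Prop1Explicit.Site d × Fin d)) : B6RandomWalk.Triangle254 (cubeGeometry L j S T) := by
  intro a b c
  show (B7Prop1Explicit.l1 (Subtype.val a - Subtype.val c) : ℝ) ≤ (B7Prop1Explicit.l1 (Subtype.val a - Subtype.val b) : ℝ) + (B7Prop1Explicit.l1 (Subtype.val b - Subtype.val c) : ℝ)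
  exact_mod_cast l1_sub_triangle (Subtype.val a) (Subtype.val b) (Subtype.val c)

/-- Distances are nonnegative. [folklore] [cite: Balaban1984PropagatorsII, (2.46) p.229] -/
theorem dist_nonneg_cubeGeometry (L j : ℕ) (S T : Finset (B7Prop1Explicit.Site d × Fin d)) (a b : (cubeGeometry L j S T).Site) :
    0 ≤ (cubeGeometry L j S T).dist a b := by
  show (0 : ℝ) ≤ (B7Prop1Explicit.l1 (Subtype.val a - Subtype.val b) : ℝ)
  positivity

/-- **LEMMA 2.1 [3] SHAPE FOR THE CUBE GEOMETRY** (single scale): `Σ_{y′} e^{−αδ₀|y − y′|₁} ≤ c₀(δ₀, α)ᵈ` for every site `y` and every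
rate `αδ₀ > 0` (`B6Lemma21TwoScale.singleScale_row_sum`), i.e. `RowSum (cubeGeometry …) (αδ₀) (c₀(δ₀,α)ᵈ)`.
[cite: Balaban1984PropagatorsII, Lemma 2.1 (2.61) p.234] -/
theorem rowSum_cubeGeometry (L j : ℕ) (S T : Finset (B7Prop1Explicit.Site d × Fin d)) {δ₀ α : ℝ} (h : 0 < α * δ₀) :
    RowSum (cubeGeometry L j S T) (α * δ₀) (B6.c0 δ₀ α ^ d) := by
  classical
  intro y
  have hinj : Set.InjOn (fun y' : (cubeGeometry L j S T).Site => (Subtype.val y - Subtype.val y' : B7Prop1Explicit.Site d))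
      ↑(Finset.univ : Finset (cubeGeometry L j S T).Site) := by
    intro a _ b _ hab
    have h' : Subtype.val y - Subtype.val a = Subtype.val y - Subtype.val b := hab
    exact Subtype.ext (sub_right_injective h')
  have hsum := B6Lemma21TwoScale.singleScale_row_sum h (Finset.univ : Finset (cubeGeometry L j S T).Site)
    (fun y' => (Subtype.val y - Subtype.val y' : B7Prop1Explicit.Site d)) hinj (fun y' => (B7Prop1Explicit.l1 (Subtype.val y - Subtype.val y') : ℝ))
    (fun y' _ => le_of_eq rfl)
  exact hsum

variable (L j : ℕ) (S T : Finset (B7Prop1Explicit.Site d × Fin d))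

/-- The block of a fine bond: the cube of its base point. [cite: Balaban1985Variational, (73) p.289] -/
def blkS (s : S) : (cubeGeometry L j S T).Site :=
  Subtype.mk (cube L j s.1.1) (Finset.mem_union_right _ (Finset.mem_image_of_mem (fun s : B7Prop1Explicit.Site d × Fin d => cube L j s.1) s.2))

/-- The block of a coarse bond: its base point. [cite: Balaban1985Variational, (73) p.289] -/
def blkT (c : T) : (cubeGeometry L j S T).Site :=
  Subtype.mk c.1.1 (Finset.mem_union_left _ (Finset.mem_image_of_mem (fun c : B7Prop1Explicit.Site d × Fin d => c.1) c.2))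

/-- Unfolding: the block of a fine bond is the cube of its base point. [cite: Balaban1985Variational, (73) p.289] -/
@[simp] theorem blkS_val (s : S) : (Subtype.val (blkS L j S T s) : B7Prop1Explicit.Site d) = cube L j s.1.1 := rfl

/-- Unfolding: the block of a coarse bond is its base point. [cite: Balaban1985Variational, (73) p.289] -/
@[simp] theorem blkT_val (c : T) : (Subtype.val (blkT L j S T c) : B7Prop1Explicit.Site d) = c.1.1 := rfl

/-- The sharp boxes of the fine bonds. [cite: Balaban1985Variational, (190) p.308 («x ∈ Δ(y)»)] -/
def boxS (y : (cubeGeometry L j S T).Site) : Finset S := Finset.univ.filter fun s => blkS L j S T s = y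

/-- The sharp boxes of the coarse bonds. [cite: Balaban1985Variational, (190) p.308 («x ∈ Δ(y)»)] -/
def boxT (y : (cubeGeometry L j S T).Site) : Finset T := Finset.univ.filter fun c => blkT L j S T c = y


end CubeGeometry

/-! ## §3 (73) as a `HasMaj` letter for the concrete `𝔇 = (δ/δA′)D(A′)` -/

section Concrete73

open B7Prop1Explicit B7Prop1Local B7Prop2Explicit B7Prop3Flat B7Prop4Flat B7Eq92Concrete B7Prop3GeneralLinear
  B7Prop4GeneralLevels B7Prop5GeneralOperators B7Prop5GeneralInduction B7Prop5GeneralLevels B7Prop5General B7Ineq149Pairing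
  B13Contraction113 B11Eq44Concrete B11Prop3Model


variable {d : ℕ} {𝔸 : Type} [NormedRing 𝔸] [NormedAlgebra ℂ 𝔸] [CompleteSpace 𝔸] [NormOneClass 𝔸]

variable (L : ℕ) (hL : 2 ≤ L) {G : Subgroup 𝔸ˣ} (hG : AvgClosed d L G) (k : ℕ)
  (U₀ : B7Prop1Explicit.Site d → Fin d → 𝔸ˣ) (hU₀ : ∀ x κ, U₀ x κ ∈ G) {α₀ : ℝ} (hα : 0 < α₀)
  (hα3 : C0 d * α₀ ≤ 1 / 3) (hα4 : 4 * α₀ ≤ c2' d L) (h52 : pdev U₀ < α₀ * (((L : ℝ) ^ k)⁻¹) ^ 2)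
  {b : ℝ} (hb : 0 < b)
  (hsmall : Real.exp (4 * (800 * ((d : ℝ) + 1) ^ 2 * ((d : ℝ) + 4)) * α₀)
    * (1 + 8 * (131072 * ((d : ℝ) + 1) ^ 2) * ((L : ℝ) ^ k * b)) ≤ 2)
  (hc₃ : 4 * ((L : ℝ) ^ k * b) < c3 d L)
  (h145 : 8 * d * thetaGen d L α₀ * (L : ℝ)⁻¹ ^ 4 ≤ 1)
  (h155 : (2 * (L : ℝ) - 1) * (L : ℝ)⁻¹ ^ 2 + 2 * d * thetaGen d L α₀ * (L : ℝ)⁻¹ ^ 3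
    + 1 / 8 * (1 + 2 * d * thetaGen d L α₀ * (L : ℝ)⁻¹ ^ 2 + 2 * d * C3Gen d L * ((L : ℝ) ^ k * b)) * (L : ℝ)⁻¹ ^ 2 ≤ 1)
  (S T : Finset (B7Prop1Explicit.Site d × Fin d)) (H : (T → 𝔸) →L[ℂ] (S → 𝔸)) {B₀ B₁ δ₀ ε : ℝ}

include hL hG hU₀ hα hα3 hα4 h52 hb hsmall hc₃ h145 h155 in
/-- **(73) AS A `HasMaj` LETTER FOR THE CONCRETE `𝔇`**: in the regime of `B11Eq73KernelConcrete.ineq73_Dfix` (p06 g7: (73) with decay for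
the selector `D(A′) = Dfix (C_j(U₀,·)) H (C₂(Lʲ)²)`, modulo the H-kernel letter `hHker` and `q < 1`), for every `‖A′‖ < ε` the actual
derivative `(δ/δA′)D(A′) = fderiv ℂ (Dfix …) A′` has the MAJORANT `θ_D·e^{−½δ₀|y − y′|₁}` from the sup size of the fine bonds to the sup
size of the coarse bonds of the cube geometry — the one-scale kernel reading of (73) (print: *«|𝔇(A′; c, b)| ≦ O(1)C₃ε₃(L^jη)^{−d+1}
e^{−(1/2)δ₀d(c₋,y)}, b ∈ B^j(y), y ∈ Λ_j»*; tree units `|𝔇(A′)(X·e_b)(c)| ≤ O(1)·C₃(Lʲ)²·2ε·L^{−jd}·‖X‖·e^{−½δ₀|Lʲz_c − b|₁/Lʲ}`) summed over the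
`≤ d·L^{jd}` fine bonds of a cube: `θ_D = d·e^{½dδ₀}·(1 − q)⁻¹·e^{dδ₀}·C₃(Lʲ)²·2ε`. [cite: Balaban1985Variational, (73) p.289, Prop. 3 p.289, (190) p.308] -/
theorem hasMaj_fderiv_Dfix {j : ℕ} (hj : j ≤ k) (hB₀ : 0 ≤ B₀) (hH : ∀ X, ‖H X‖ ≤ B₀ * ‖X‖)
    (hq9 : 9 * ((8 * (131072 * ((d : ℝ) + 1) ^ 2) * Real.exp (4 * (800 * ((d : ℝ) + 1) ^ 2 * ((d : ℝ) + 4)) * α₀))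
      * ((L : ℝ) ^ j) ^ 2) * B₀ * ε < 1) (hε3 : 3 * ε < b)
    (hδ₀ : 0 < δ₀) (hB₁ : 0 ≤ B₁)
    (hHker : ∀ (c'' : T) (Y : 𝔸) (s : S),
      ‖H (Pi.single c'' Y) s‖ ≤ B₁ * Real.exp (-(δ₀ * ((B7Prop1Explicit.l1 (loK L j c''.1.1 - s.1.1) : ℝ) / (L : ℝ) ^ j))) * ‖Y‖)
    (hq : (C3Gen d L * (((L : ℝ) ^ j) ^ 2 * (2 * ε)) * (2 * d) * B₁ * Real.exp (2 * d * δ₀)) * (d * B6.c0 δ₀ (1 / 2) ^ d) < 1)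
    (hε : 0 ≤ ε) {A' : S → 𝔸} (hA : ‖A'‖ < ε) :
    HasMaj (supSize (cubeGeometry L j S T) (boxS L j S T) (blkS L j S T) : BlockNorm (cubeGeometry L j S T) (S → 𝔸))
      (supSize (cubeGeometry L j S T) (boxT L j S T) (blkT L j S T) : BlockNorm (cubeGeometry L j S T) (T → 𝔸))
      ((fderiv ℂ (Dfix (Cmap L U₀ S T j) (H : (T → 𝔸) →ₗ[ℂ] (S → 𝔸))
          ((8 * (131072 * ((d : ℝ) + 1) ^ 2) * Real.exp (4 * (800 * ((d : ℝ) + 1) ^ 2 * ((d : ℝ) + 4)) * α₀)) *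
            ((L : ℝ) ^ j) ^ 2)) A').restrictScalars ℝ : (S → 𝔸) →ₗ[ℝ] (T → 𝔸))
      (fun y y' => (d * Real.exp (1 / 2 * d * δ₀) *
          ((1 - (C3Gen d L * (((L : ℝ) ^ j) ^ 2 * (2 * ε)) * (2 * d) * B₁ * Real.exp (2 * d * δ₀)) *
              (d * B6.c0 δ₀ (1 / 2) ^ d))⁻¹ * (Real.exp (d * δ₀) * (C3Gen d L * ((L : ℝ) ^ j) ^ 2 * (2 * ε))))) *
        Real.exp (-(δ₀ / 2 * (cubeGeometry L j S T).dist y y'))) := by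
  classical
  have hL1 : 1 ≤ L := le_trans (by norm_num) hL
  -- abbreviations
  set Q : ℝ := (C3Gen d L * (((L : ℝ) ^ j) ^ 2 * (2 * ε)) * (2 * d) * B₁ * Real.exp (2 * d * δ₀)) * (d * B6.c0 δ₀ (1 / 2) ^ d)
    with hQ_def
  set M : ℝ := (1 - Q)⁻¹ * (Real.exp (d * δ₀) * (C3Gen d L * ((L : ℝ) ^ j) ^ 2 * (2 * ε))) with hM_def
  have hQ1 : 0 < 1 - Q := by linarith
  have hC3 : 0 ≤ C3Gen d L := by unfold C3Gen C1ppGen; positivity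
  have hM : 0 ≤ M := by
    rw [hM_def]
    exact mul_nonneg (inv_nonneg.2 hQ1.le) (by positivity)
  have hLjd : (0 : ℝ) < ((L : ℝ) ^ j) ^ d := by positivity
  -- the kernel κ(c, b) of (73)
  refine hasMaj_supSize_of_kernel (boxS L j S T) (blkS L j S T) (boxT L j S T) (blkT L j S T)
    (fun s => Finset.mem_filter.2 ⟨Finset.mem_univ _, rfl⟩) _
    (fun c bnd => M * (((L : ℝ) ^ j) ^ d)⁻¹ *
      Real.exp (-(1 / 2 * δ₀ * ((B7Prop1Explicit.l1 (loK L j c.1.1 - bnd.1.1) : ℝ) / (L : ℝ) ^ j))))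
    (fun c bnd => by positivity) (fun bnd X c => ?_) _ (fun y y' => by positivity) (fun y y' c hc => ?_)
  · -- the kernel bound = `ineq73_Dfix`, rearranged
    have h73 := B11Eq73KernelConcrete.ineq73_Dfix L hL hG k U₀ hU₀ hα hα3 hα4 h52 hb hsmall hc₃ h145 h155 S T H hj hB₀ hH
      hq9 hε3 hδ₀ hB₁ hHker hq hA bnd X c
    calc ‖((fderiv ℂ (Dfix (Cmap L U₀ S T j) (H : (T → 𝔸) →ₗ[ℂ] (S → 𝔸))
            ((8 * (131072 * ((d : ℝ) + 1) ^ 2) * Real.exp (4 * (800 * ((d : ℝ) + 1) ^ 2 * ((d : ℝ) + 4)) * α₀)) *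
              ((L : ℝ) ^ j) ^ 2)) A').restrictScalars ℝ : (S → 𝔸) →ₗ[ℝ] (T → 𝔸)) (Pi.single bnd X) c‖
        = ‖fderiv ℂ (Dfix (Cmap L U₀ S T j) (H : (T → 𝔸) →ₗ[ℂ] (S → 𝔸))
            ((8 * (131072 * ((d : ℝ) + 1) ^ 2) * Real.exp (4 * (800 * ((d : ℝ) + 1) ^ 2 * ((d : ℝ) + 4)) * α₀)) *
              ((L : ℝ) ^ j) ^ 2)) A' (Pi.single bnd X) c‖ := rfl
      _ ≤ _ := h73
      _ = M * (((L : ℝ) ^ j) ^ d)⁻¹ *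
            Real.exp (-(1 / 2 * δ₀ * ((B7Prop1Explicit.l1 (loK L j c.1.1 - bnd.1.1) : ℝ) / (L : ℝ) ^ j))) * ‖X‖ := by
          rw [hM_def]; ring
  · -- the block row sum: ≤ d·L^{jd} fine bonds in the cube of y′, each at distance ≥ |y − y′|₁ − d
    have hc' : (c.1.1 : B7Prop1Explicit.Site d) = Subtype.val y := by
      have := (Finset.mem_filter.1 hc).2
      exact congrArg Subtype.val this
    set F := (Finset.univ : Finset S).filter (fun s => blkS L j S T s = y') with hF_def
    have hFsub : F ⊆ (Finset.univ : Finset S).filter (fun s : S => cube L j s.1.1 = Subtype.val y') := by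
      intro s hs
      rw [hF_def, Finset.mem_filter] at hs
      exact Finset.mem_filter.2 ⟨Finset.mem_univ _, congrArg Subtype.val hs.2⟩
    have hFcard : (F.card : ℝ) ≤ d * ((L : ℝ) ^ j) ^ d := by
      have h1 := Finset.card_le_card hFsub
      have h2 := card_filter_cube_le hL1 j S (Subtype.val y')
      have h3 : (F.card : ℝ) ≤ ((d * (L ^ j) ^ d : ℕ) : ℝ) := by exact_mod_cast h1.trans h2
      simpa using h3
    -- each term of the row sum
    have hterm : ∀ s ∈ F, M * (((L : ℝ) ^ j) ^ d)⁻¹ *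
        Real.exp (-(1 / 2 * δ₀ * ((B7Prop1Explicit.l1 (loK L j c.1.1 - s.1.1) : ℝ) / (L : ℝ) ^ j)))
        ≤ M * (((L : ℝ) ^ j) ^ d)⁻¹ * (Real.exp (1 / 2 * d * δ₀) *
          Real.exp (-(1 / 2 * δ₀ * (B7Prop1Explicit.l1 (Subtype.val y - Subtype.val y') : ℝ)))) := by
      intro s hs
      rw [hF_def, Finset.mem_filter] at hs
      have hsq : cube L j s.1.1 = Subtype.val y' := congrArg Subtype.val hs.2
      have h := exp_offset_le hL1 j hδ₀.le c.1.1 s.1.1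
      rw [hc', hsq] at h
      rw [hc'] 
      exact mul_le_mul_of_nonneg_left h (by positivity)
    calc ∑ s ∈ F, M * (((L : ℝ) ^ j) ^ d)⁻¹ *
          Real.exp (-(1 / 2 * δ₀ * ((B7Prop1Explicit.l1 (loK L j c.1.1 - s.1.1) : ℝ) / (L : ℝ) ^ j)))
        ≤ ∑ s ∈ F, M * (((L : ℝ) ^ j) ^ d)⁻¹ * (Real.exp (1 / 2 * d * δ₀) *
            Real.exp (-(1 / 2 * δ₀ * (B7Prop1Explicit.l1 (Subtype.val y - Subtype.val y') : ℝ)))) := Finset.sum_le_sum hterm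
      _ = F.card * (M * (((L : ℝ) ^ j) ^ d)⁻¹ * (Real.exp (1 / 2 * d * δ₀) *
            Real.exp (-(1 / 2 * δ₀ * (B7Prop1Explicit.l1 (Subtype.val y - Subtype.val y') : ℝ))))) := by
          rw [Finset.sum_const, nsmul_eq_mul]
      _ ≤ (d * ((L : ℝ) ^ j) ^ d) * (M * (((L : ℝ) ^ j) ^ d)⁻¹ * (Real.exp (1 / 2 * d * δ₀) *
            Real.exp (-(1 / 2 * δ₀ * (B7Prop1Explicit.l1 (Subtype.val y - Subtype.val y') : ℝ))))) :=
          mul_le_mul_of_nonneg_right hFcard (by positivity)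
      _ = (d * Real.exp (1 / 2 * d * δ₀) * M) *
            Real.exp (-(δ₀ / 2 * (cubeGeometry L j S T).dist y y')) := by
          rw [dist_cubeGeometry]
          field_simp

end Concrete73

/-! ## §4 The (190) chain at the concrete `C_j` with the (73)-letter discharged -/

section Chain

open B7Prop1Explicit B7Prop1Local B7Prop2Explicit B7Prop3Flat B7Prop4Flat B7Eq92Concrete B7Prop3GeneralLinear
  B7Prop4GeneralLevels B7Prop5GeneralOperators B7Prop5GeneralInduction B7Prop5GeneralLevels B7Prop5General B7Ineq149Pairing
  B13Contraction113 B11Eq44Concrete B11Prop3Model B11Eq174Chart B11Eq183Differentiation B11Presentation190 B11Ineq190Actual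
  B11Ineq190FromProp3 B6RandomWalk Set Metric


variable {d : ℕ} {𝔸 : Type} [NormedRing 𝔸] [NormedAlgebra ℂ 𝔸] [CompleteSpace 𝔸] [NormOneClass 𝔸]

variable (L : ℕ) (hL : 2 ≤ L) {G : Subgroup 𝔸ˣ} (hG : AvgClosed d L G) (k : ℕ)
  (U₀ : B7Prop1Explicit.Site d → Fin d → 𝔸ˣ) (hU₀ : ∀ x κ, U₀ x κ ∈ G) {α₀ : ℝ} (hα : 0 < α₀)
  (hα3 : C0 d * α₀ ≤ 1 / 3) (hα4 : 4 * α₀ ≤ c2' d L) (h52 : pdev U₀ < α₀ * (((L : ℝ) ^ k)⁻¹) ^ 2)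
  {b : ℝ} (hb : 0 < b)
  (hsmall : Real.exp (4 * (800 * ((d : ℝ) + 1) ^ 2 * ((d : ℝ) + 4)) * α₀)
    * (1 + 8 * (131072 * ((d : ℝ) + 1) ^ 2) * ((L : ℝ) ^ k * b)) ≤ 2)
  (hc₃ : 4 * ((L : ℝ) ^ k * b) < c3 d L)
  (h145 : 8 * d * thetaGen d L α₀ * (L : ℝ)⁻¹ ^ 4 ≤ 1)
  (h155 : (2 * (L : ℝ) - 1) * (L : ℝ)⁻¹ ^ 2 + 2 * d * thetaGen d L α₀ * (L : ℝ)⁻¹ ^ 3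
    + 1 / 8 * (1 + 2 * d * thetaGen d L α₀ * (L : ℝ)⁻¹ ^ 2 + 2 * d * C3Gen d L * ((L : ℝ) ^ k * b)) * (L : ℝ)⁻¹ ^ 2 ≤ 1)
  (S T : Finset (B7Prop1Explicit.Site d × Fin d))

variable {𝒵 : Type} [NormedAddCommGroup 𝒵] [NormedSpace ℂ 𝒵] [CompleteSpace 𝒵]
  {𝒢 : 𝒵 →L[ℂ] (S → 𝔸)} {W : (S → 𝔸) → 𝒵} {D2 : (S → 𝔸) →L[ℂ] 𝒵} {H₀ : (T → 𝔸) →L[ℂ] (S → 𝔸)} {B₀ θ C₄ a₃ jG a ε₄ : ℝ}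
  {X : Type} {E : Type} [NormedAddCommGroup E] [NormedSpace ℝ E]

include hL hG hU₀ hα hα3 hα4 h52 hb hsmall hc₃ h145 h155 in
/-- **THE END-TO-END (190) CHAIN AT THE CONCRETE `C_j` ON THE CUBE GEOMETRY, (73)-LETTER DISCHARGED** —
`B11Ineq190ConcreteC.ineq190_and_hmv_supSize_concreteC` (r08 g10) with `g :=` the single-scale cube geometry of `(S, T)`, `bN`, `bB :=` the
sup sizes of the fine / coarse bonds, and the letters `h73` ((73) majorant of the actual derivative of `Dfix` at the points of the (180)
domain — §3 with `ε := ε₃`, the points lying in the `ε₃`-ball by `B11Ineq190FromProp3.norm_arg180_lt_eps3`), `hN`, `hBloc` (§1), `htri`,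
`hd`, `hrow` (§2: `ℓ¹` triangle inequality, Lemma 2.1 [3] shape at rate `⅛δ₀` with `c = c₀(δ₀, ⅛)ᵈ`) ALL DISCHARGED.  Hypotheses left: the
located leaves of `B11Ineq190Actual` for the ABSTRACT Sect. G data on the cube sizes ((189) `h189`, kernel letters of `G̃`/`Δ⁽²⁾H₀`/`H₀`/`H`,
size ↔ presentation compatibility `hev`, `q_G < 1`), the H-kernel letter `hHker` ([5] Thm 3.12 in kernel form) with its smallness `hq`,
the Sect. G `Regime`, `W`-analyticity, (46) and the Prop. 3 smallness in tree units.
[cite: Balaban1985Variational, Prop. 9 (190) pp.308–309, (73) p.289, Prop. 3 p.289] [cite: Balaban1984PropagatorsII, Lemma 2.1 (2.61) p.234] -/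
theorem ineq190_and_hmv_supSize_concreteC_kernel {j : ℕ} (hj : j ≤ k) (hd1 : 1 ≤ d)
    (R : Regime 𝒢 0 W B₀ θ C₄ a₃ jG a ε₄) (hWa : AnalyticOnNhd ℂ W {Y : S → 𝔸 | ‖Y‖ < a₃})
    (H : (T → 𝔸) →L[ℂ] (S → 𝔸)) {B₀' : ℝ} (hB₀' : 0 ≤ B₀') (hH46 : ∀ X, ‖H X‖ ≤ B₀' * ‖X‖)
    {c1h ε₃ : ℝ} (hc1h : 1 ≤ c1h) (hε₃ : 0 < ε₃)
    (h18 : 18 * ((8 * (131072 * ((d : ℝ) + 1) ^ 2) * Real.exp (4 * (800 * ((d : ℝ) + 1) ^ 2 * ((d : ℝ) + 4)) * α₀)) *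
      ((L : ℝ) ^ j) ^ 2) * B₀' * d * c1h * ε₃ ≤ 1) (h2 : 2 * ε₃ ≤ b / 2) (hnest : ε₄ + a ≤ ε₃)
    {δ₀ B₁ : ℝ} (hδ₀ : 0 < δ₀) (hB₁ : 0 ≤ B₁)
    (hHker : ∀ (c'' : T) (Y : 𝔸) (s : S),
      ‖H (Pi.single c'' Y) s‖ ≤ B₁ * Real.exp (-(δ₀ * ((B7Prop1Explicit.l1 (loK L j c''.1.1 - s.1.1) : ℝ) / (L : ℝ) ^ j))) * ‖Y‖)
    (hq : (C3Gen d L * (((L : ℝ) ^ j) ^ 2 * (2 * ε₃)) * (2 * d) * B₁ * Real.exp (2 * d * δ₀)) * (d * B6.c0 δ₀ (1 / 2) ^ d) < 1)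
    {B : T → 𝔸} (hB : ‖H₀ B‖ < a ∧ ‖D2 (H₀ B)‖ < jG)
    {box : (cubeGeometry L j S T).Site → Finset X} {blk : X → (cubeGeometry L j S T).Site} (ev : X → ((S → 𝔸) →L[ℝ] E))
    {b3 : BlockNorm (cubeGeometry L j S T) 𝒵}
    (hev : ∀ (y : (cubeGeometry L j S T).Site) (v : S → 𝔸), ∀ x ∈ box y,
      ‖ev x v‖ ≤ (supSize (cubeGeometry L j S T) (boxS L j S T) (blkS L j S T) :
        BlockNorm (cubeGeometry L j S T) (S → 𝔸)).loc y v)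
    {BG θW cΔ A₀ AH : ℝ} (hBG : 0 ≤ BG) (hθW : 0 ≤ θW) (hcΔ : 0 ≤ cΔ) (hA₀ : 0 ≤ A₀) (hAH : 0 ≤ AH)
    (hG190 : HasMaj b3 (supSize (cubeGeometry L j S T) (boxS L j S T) (blkS L j S T) : BlockNorm (cubeGeometry L j S T) (S → 𝔸))
      (𝒢.restrictScalars ℝ : 𝒵 →ₗ[ℝ] (S → 𝔸)) (fun y y' => BG * Real.exp (-(δ₀ * (cubeGeometry L j S T).dist y y'))))
    (hD2H0 : HasMaj (supSize (cubeGeometry L j S T) (boxT L j S T) (blkT L j S T) : BlockNorm (cubeGeometry L j S T) (T → 𝔸)) b3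
      ((D2 ∘L H₀).restrictScalars ℝ : (T → 𝔸) →ₗ[ℝ] 𝒵) (fun y y' => cΔ * Real.exp (-(δ₀ * (cubeGeometry L j S T).dist y y'))))
    (hH0 : HasMaj (supSize (cubeGeometry L j S T) (boxT L j S T) (blkT L j S T) : BlockNorm (cubeGeometry L j S T) (T → 𝔸))
      (supSize (cubeGeometry L j S T) (boxS L j S T) (blkS L j S T) : BlockNorm (cubeGeometry L j S T) (S → 𝔸))
      (H₀.restrictScalars ℝ : (T → 𝔸) →ₗ[ℝ] (S → 𝔸)) (fun y y' => A₀ * Real.exp (-(δ₀ * (cubeGeometry L j S T).dist y y'))))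
    (hH : HasMaj (supSize (cubeGeometry L j S T) (boxT L j S T) (blkT L j S T) : BlockNorm (cubeGeometry L j S T) (T → 𝔸))
      (supSize (cubeGeometry L j S T) (boxS L j S T) (blkS L j S T) : BlockNorm (cubeGeometry L j S T) (S → 𝔸))
      (H.restrictScalars ℝ : (T → 𝔸) →ₗ[ℝ] (S → 𝔸)) (fun y y' => AH * Real.exp (-(δ₀ / 2 * (cubeGeometry L j S T).dist y y'))))
    (h189 : ∀ B' : T → 𝔸, ‖H₀ B'‖ < a → ‖D2 (H₀ B')‖ < jG →
      Ineq189 (supSize (cubeGeometry L j S T) (boxS L j S T) (blkS L j S T) : BlockNorm (cubeGeometry L j S T) (S → 𝔸)) b3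
        ((fderiv ℂ W (solA180 𝒢 W D2 H₀ ε₄ B' + H₀ B')).restrictScalars ℝ : (S → 𝔸) →ₗ[ℝ] 𝒵) θW δ₀)
    (hqG : qG b3.κ 1 BG θW (B6.c0 δ₀ (1 / 8) ^ d) < 1)
    (Hl : (T → 𝔸) → X → E) (dH : Icc (0:ℝ) 1 → (T → 𝔸) →ₗ[ℝ] (X → E))
    (hHl : ∀ B' : T → 𝔸, Hl B' = fun x => ev x (chartH179 𝒢 W D2 H₀
      (fun Y : S → 𝔸 => Y - H (Dfix (B11Eq44Concrete.Cmap L U₀ S T j) (H : (T → 𝔸) →ₗ[ℂ] (S → 𝔸))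
        ((8 * (131072 * ((d : ℝ) + 1) ^ 2) * Real.exp (4 * (800 * ((d : ℝ) + 1) ^ 2 * ((d : ℝ) + 4)) * α₀)) * ((L : ℝ) ^ j) ^ 2) Y))
      ε₄ B'))
    (hdH : ∀ t : Icc (0:ℝ) 1, dH t = (LinearMap.pi fun x => ((ev x : (S → 𝔸) →L[ℝ] E) : (S → 𝔸) →ₗ[ℝ] E)) ∘ₗ
      ((fderiv ℂ (chartH179 𝒢 W D2 H₀
        (fun Y : S → 𝔸 => Y - H (Dfix (B11Eq44Concrete.Cmap L U₀ S T j) (H : (T → 𝔸) →ₗ[ℂ] (S → 𝔸))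
          ((8 * (131072 * ((d : ℝ) + 1) ^ 2) * Real.exp (4 * (800 * ((d : ℝ) + 1) ^ 2 * ((d : ℝ) + 4)) * α₀)) * ((L : ℝ) ^ j) ^ 2) Y))
        ε₄) ((t : ℝ) • B)).restrictScalars ℝ : (T → 𝔸) →ₗ[ℝ] (S → 𝔸)))
    (y : (cubeGeometry L j S T).Site) :
    (∀ t : Icc (0:ℝ) 1, Ineq190 (supSize (cubeGeometry L j S T) (boxT L j S T) (blkT L j S T) : BlockNorm (cubeGeometry L j S T) (T → 𝔸))
        (supSize (cubeGeometry L j S T) box blk : BlockNorm (cubeGeometry L j S T) (X → E)) (dH t)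
        (const190 1 1 b3.κ BG θW cΔ A₀ AH
          (d * Real.exp (1 / 2 * d * δ₀) *
            ((1 - (C3Gen d L * (((L : ℝ) ^ j) ^ 2 * (2 * ε₃)) * (2 * d) * B₁ * Real.exp (2 * d * δ₀)) *
                (d * B6.c0 δ₀ (1 / 2) ^ d))⁻¹ * (Real.exp (d * δ₀) * (C3Gen d L * ((L : ℝ) ^ j) ^ 2 * (2 * ε₃)))))
          (B6.c0 δ₀ (1 / 8) ^ d)) δ₀) ∧
      ∀ s : ℝ, (∀ t, (supSize (cubeGeometry L j S T) box blk : BlockNorm (cubeGeometry L j S T) (X → E)).loc y (dH t B) ≤ s) →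
        (supSize (cubeGeometry L j S T) box blk : BlockNorm (cubeGeometry L j S T) (X → E)).loc y (Hl B) ≤ s := by
  classical
  -- the discharged letters
  have hN : ∀ (y : (cubeGeometry L j S T).Site) (v : S → 𝔸),
      (supSize (cubeGeometry L j S T) (boxS L j S T) (blkS L j S T) : BlockNorm (cubeGeometry L j S T) (S → 𝔸)).loc y v ≤ ‖v‖ :=
    fun y v => loc_le_norm_supSize (blkS L j S T) y v
  have hBloc : ∀ (y' : (cubeGeometry L j S T).Site) (μ : T → 𝔸),
      (supSize (cubeGeometry L j S T) (boxT L j S T) (blkT L j S T) : BlockNorm (cubeGeometry L j S T) (T → 𝔸)).IsLoc y' μ →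
        ‖μ‖ ≤ (supSize (cubeGeometry L j S T) (boxT L j S T) (blkT L j S T) : BlockNorm (cubeGeometry L j S T) (T → 𝔸)).loc y' μ :=
    fun y' μ hμ => norm_le_loc_of_isLoc (blkT L j S T) y' μ hμ
  have htri : Triangle254 (cubeGeometry L j S T) := triangle254_cubeGeometry L j S T
  have hdist : ∀ a b : (cubeGeometry L j S T).Site, 0 ≤ (cubeGeometry L j S T).dist a b := dist_nonneg_cubeGeometry L j S T
  have hc0 : 0 ≤ B6.c0 δ₀ (1 / 8) := tsum_nonneg fun _ => (Real.exp_pos _).le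
  have hc : 0 ≤ B6.c0 δ₀ (1 / 8) ^ d := pow_nonneg hc0 d
  have hrow : RowSum (cubeGeometry L j S T) (δ₀ / 8) (B6.c0 δ₀ (1 / 8) ^ d) := by
    have h8 : δ₀ / 8 = 1 / 8 * δ₀ := by ring
    rw [h8]
    exact rowSum_cubeGeometry L j S T (by positivity)
  -- the (73)-letter from §3 at ε := ε₃
  have hdR : (1 : ℝ) ≤ (d : ℝ) := by exact_mod_cast hd1
  have hq9 : 9 * ((8 * (131072 * ((d : ℝ) + 1) ^ 2) * Real.exp (4 * (800 * ((d : ℝ) + 1) ^ 2 * ((d : ℝ) + 4)) * α₀))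
      * ((L : ℝ) ^ j) ^ 2) * B₀' * ε₃ < 1 := by
    have hdc : 1 ≤ (d : ℝ) * c1h := by nlinarith
    have hpos : 0 ≤ ((8 * (131072 * ((d : ℝ) + 1) ^ 2) * Real.exp (4 * (800 * ((d : ℝ) + 1) ^ 2 * ((d : ℝ) + 4)) * α₀))
      * ((L : ℝ) ^ j) ^ 2) * B₀' * ε₃ := by positivity
    calc 9 * ((8 * (131072 * ((d : ℝ) + 1) ^ 2) * Real.exp (4 * (800 * ((d : ℝ) + 1) ^ 2 * ((d : ℝ) + 4)) * α₀))
          * ((L : ℝ) ^ j) ^ 2) * B₀' * ε₃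
        ≤ 9 * ((8 * (131072 * ((d : ℝ) + 1) ^ 2) * Real.exp (4 * (800 * ((d : ℝ) + 1) ^ 2 * ((d : ℝ) + 4)) * α₀))
          * ((L : ℝ) ^ j) ^ 2) * B₀' * ε₃ * ((d : ℝ) * c1h) := le_mul_of_one_le_right (by positivity) hdc
      _ = (18 * ((8 * (131072 * ((d : ℝ) + 1) ^ 2) * Real.exp (4 * (800 * ((d : ℝ) + 1) ^ 2 * ((d : ℝ) + 4)) * α₀)) *
          ((L : ℝ) ^ j) ^ 2) * B₀' * d * c1h * ε₃) / 2 := by ring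
      _ ≤ 1 / 2 := by linarith
      _ < 1 := by norm_num
  have hε3b : 3 * ε₃ < b := by linarith
  have hC3 : 0 ≤ C3Gen d L := by unfold C3Gen C1ppGen; positivity
  have h1q : 0 < 1 - (C3Gen d L * (((L : ℝ) ^ j) ^ 2 * (2 * ε₃)) * (2 * d) * B₁ * Real.exp (2 * d * δ₀)) *
      (d * B6.c0 δ₀ (1 / 2) ^ d) := by linarith
  have hθD : (0 : ℝ) ≤ (d * Real.exp (1 / 2 * d * δ₀) *
            ((1 - (C3Gen d L * (((L : ℝ) ^ j) ^ 2 * (2 * ε₃)) * (2 * d) * B₁ * Real.exp (2 * d * δ₀)) *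
                (d * B6.c0 δ₀ (1 / 2) ^ d))⁻¹ * (Real.exp (d * δ₀) * (C3Gen d L * ((L : ℝ) ^ j) ^ 2 * (2 * ε₃))))) :=
    mul_nonneg (by positivity) (mul_nonneg (inv_nonneg.2 h1q.le) (by positivity))
  have h73 : ∀ B' : T → 𝔸, ‖H₀ B'‖ < a → ‖D2 (H₀ B')‖ < jG →
      HasMaj (supSize (cubeGeometry L j S T) (boxS L j S T) (blkS L j S T) : BlockNorm (cubeGeometry L j S T) (S → 𝔸))
        (supSize (cubeGeometry L j S T) (boxT L j S T) (blkT L j S T) : BlockNorm (cubeGeometry L j S T) (T → 𝔸))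
        ((fderiv ℂ (Dfix (B11Eq44Concrete.Cmap L U₀ S T j) (H : (T → 𝔸) →ₗ[ℂ] (S → 𝔸))
          ((8 * (131072 * ((d : ℝ) + 1) ^ 2) * Real.exp (4 * (800 * ((d : ℝ) + 1) ^ 2 * ((d : ℝ) + 4)) * α₀)) * ((L : ℝ) ^ j) ^ 2))
          (solA180 𝒢 W D2 H₀ ε₄ B' + H₀ B')).restrictScalars ℝ : (S → 𝔸) →ₗ[ℝ] (T → 𝔸))
        (fun y y' => (d * Real.exp (1 / 2 * d * δ₀) *
            ((1 - (C3Gen d L * (((L : ℝ) ^ j) ^ 2 * (2 * ε₃)) * (2 * d) * B₁ * Real.exp (2 * d * δ₀)) *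
                (d * B6.c0 δ₀ (1 / 2) ^ d))⁻¹ * (Real.exp (d * δ₀) * (C3Gen d L * ((L : ℝ) ^ j) ^ 2 * (2 * ε₃))))) *
          Real.exp (-(δ₀ / 2 * (cubeGeometry L j S T).dist y y'))) := by
    intro B' h𝔄 hJ
    have hA : ‖solA180 𝒢 W D2 H₀ ε₄ B' + H₀ B'‖ < ε₃ := norm_arg180_lt_eps3 R hJ h𝔄 hnest
    exact hasMaj_fderiv_Dfix L hL hG k U₀ hU₀ hα hα3 hα4 h52 hb hsmall hc₃ h145 h155 S T H hj hB₀' hH46 hq9 hε3b hδ₀ hB₁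
      hHker hq hε₃.le hA
  exact B11Ineq190ConcreteC.ineq190_and_hmv_supSize_concreteC L hL hG k U₀ hU₀ hα hα3 hα4 h52 hb hsmall hc₃ h145 h155 S T
    hj hd1 R hWa H hB₀' hH46 hc1h hε₃ h18 h2 hnest hB ev hev hN hBloc htri hdist hδ₀.le hrow hc hBG hθW hcΔ hA₀ hAH hθD
    hG190 hD2H0 hH0 hH h189 h73 hqG Hl dH hHl hdH y

end Chain

end Literature.MathematicalPhysics.QuantumFieldTheory.Balaban1983to89.B11Ineq73HasMajConcrete

end
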